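import Summits.HodgeConjecture.HodgeConjecture.Theorems.LimitExtensionSpecialisationOfAlgebraicityMotion
import Literature.AlgebraicGeometry.HodgeTheory.SupportedLocusClosed
import Literature.AlgebraicGeometry.HodgeTheory.HypersurfaceComplexPoints

/-!
# Route LimitExtension — `SpecialisationOfAlgebraicity` (item stmt-HodgeConjecture-2998): the `limit` half, proved

Upper semicontinuity of supports at a degeneration, smooth-locus form, on the tree's real carriers
(the hypothesis `limit` of `specialisationOfAlgebraicity_of_spread_of_limit`, with the flatness of
`f` replaced by what it is used for: an open `U ⊆ W` containing the image of `j` on which `f` is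
smooth of some relative dimension; the companion file `…OfSpread` supplies `U` by the fibre
criterion and derives the item from SPREAD alone).

* `isClosedImmersion_fiberι_left` — `W_t ⟶ W` is a closed immersion for a complex point `t`.
* `restrictCompl_map_eq_zero_of_forall_ne` — for `f : W ⟶ T` proper over a `ℂ`-scheme smooth of
  relative dimension `1`, `𝒵 ⊆ W` closed, `B ∈ Hⁱ(W(ℂ); ℂ)` and `j : V ⟶ W_{t₀}` landing in an open
  `U ⊆ W` with `U ⟶ T` smooth of relative dimension `n`: if `B|_{W_t}` dies off the slice `𝒵_t` for
  every `t ≠ t₀`, then `j^*(B|_{W_{t₀}})` dies off `j⁻¹(𝒵_{t₀})`. Vanishing is detected on compacta up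
  to homotopy (`HodgeTheory.singularCohomology_map_eq_zero_of_compact_homotopy`); a compact family of
  points of `j(V)(ℂ) ∖ 𝒵(ℂ)` lives in the smooth separated open piece `U ∩ f⁻¹T₁` (`T₁ ∋ t₀` affine)
  and moves inside `W(ℂ)`, off the closed `𝒵(ℂ)`, into a fibre `W_{t₁}`, `t₁ ≠ t₀`
  (`exists_motion_off_fibre`, local Ehresmann by compactly supported flows), where `B` dies off
  `𝒵_{t₁}`; the moved points are lifted into `W_{t₁}(ℂ)` along the closed embedding `ι_{t₁}(ℂ)`.
-/

noncomputable section

-- `Summit.HodgeConjecture.HodgeConjecture.Theorems` is the mandated namespace (single-conjunct summit: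
-- Sub = Summit), which `linter.dupNamespace` flags on every declaration; the lakefile turns the
-- linter off tree-wide (weak option), restated here so stand-alone elaboration is warning-free too.
set_option linter.dupNamespace false

open scoped Topology
open Set Function Filter

namespace Summit.HodgeConjecture.HodgeConjecture.Theorems

/-! ### Upper semicontinuity of supports at a degeneration (smooth-locus form) -/

section Limit

open CategoryTheory AlgebraicGeometry
open Literature.AlgebraicGeometry.Motives Literature.AlgebraicGeometry.HodgeTheory
open Literature.AlgebraicTopology.SingularHomology

/-- The fibre inclusion `W_t ⟶ W` over a complex point `t` is a closed immersion: it is the base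
change of `t : Spec ℂ ⟶ T`, a section of `T ⟶ Spec ℂ` and hence a closed immersion (the target
`Spec ℂ` being a point). [folklore] -/
theorem isClosedImmersion_fiberι_left {T W : SchemeOver ℂ} (f : W ⟶ T) (t : ComplexPoints T) :
    IsClosedImmersion (fiberι f t).left := by
  haveI : Subsingleton ↥(specOver ℂ ℂ).left :=
    inferInstanceAs (Subsingleton (PrimeSpectrum ℂ))
  haveI : IsClosedImmersion t.left :=
    isClosedImmersion_of_comp_eq_id _ _ (ComplexPoints.toSpecHom_comp_hom t)
  change IsClosedImmersion (Limits.pullback.fst f.left t.left)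
  infer_instance

/-- **Upper semicontinuity of supports at a degeneration, smooth-locus form.** Let `f : W ⟶ T` be
proper over a `ℂ`-scheme `T` smooth of relative dimension `1`, `t₀ ∈ T(ℂ)`, `𝒵 ⊆ W` Zariski-closed,
`B ∈ Hⁱ(W(ℂ); ℂ)`, and `j : V ⟶ W_{t₀}` a morphism into the special fibre whose image lies in an open
`U ⊆ W` on which `f` is smooth of relative dimension `n`. If the restriction `B|_{W_t}` dies off the
slice `𝒵_t` for every `t ≠ t₀`, then `j^* B|_{W_{t₀}}` dies off `j⁻¹(𝒵_{t₀})`. Proof: vanishing of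
the restricted class is detected on compacta up to homotopy
(`HodgeTheory.singularCohomology_map_eq_zero_of_compact_homotopy`); a compact family of points of
`j(V)(ℂ) ∖ 𝒵(ℂ)` lives in the smooth, separated open piece `U ∩ f⁻¹T₁` (`T₁ ∋ t₀` affine) and moves,
inside `W(ℂ)` and off the closed `𝒵(ℂ)`, into a nearby fibre `W_{t₁}`, `t₁ ≠ t₀`
(`exists_motion_off_fibre`), where `B` dies off `𝒵_{t₁}`. [cite: VoisinHodgeI2002, Thm. 9.3 (proof)] -/
theorem restrictCompl_map_eq_zero_of_forall_ne {i n : ℕ} {V T W : SchemeOver ℂ} (f : W ⟶ T)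
    (t₀ : ComplexPoints T) (j : V ⟶ fiberOver f t₀) (𝒵 : Set W.left) (B : complexBetti W i)
    (hT : SmoothOfRelativeDimension 1 T.hom) (hf : IsProper f.left) (h𝒵 : IsClosed 𝒵)
    (hU : ∃ U : W.left.Opens, Set.range (j ≫ fiberι f t₀).left.base ⊆ (U : Set W.left) ∧
      SmoothOfRelativeDimension n (U.ι ≫ f.left))
    (hdies : ∀ t : ComplexPoints T, t ≠ t₀ →
      complexBetti.restrictCompl (fiberOver f t) ((fiberι f t).left.base ⁻¹' 𝒵) i
        (complexBetti.map (fiberι f t) i B) = 0) :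
    complexBetti.restrictCompl V ((j ≫ fiberι f t₀).left.base ⁻¹' 𝒵) i
      (complexBetti.map (j ≫ fiberι f t₀) i B) = 0 := by
  -- the restriction in question is the pull-back along `ι₀ : (V ∖ Z₀)(ℂ) → W(ℂ)`
  set Z₀ : Set V.left := (j ≫ fiberι f t₀).left.base ⁻¹' 𝒵 with hZ₀
  set ι₀ : C(complexPointsCompl V Z₀, ComplexPoints W) :=
    (AlgPoints.mapContinuous (L := ℂ) (j ≫ fiberι f t₀)).comp ⟨Subtype.val, continuous_subtype_val⟩
    with hι₀
  have hgoal : complexBetti.restrictCompl V Z₀ i (complexBetti.map (j ≫ fiberι f t₀) i B) =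
      singularCohomology.map ℂ ℂ ι₀ i B := by
    change (singularCohomology.map ℂ ℂ _ i ≫ singularCohomology.map ℂ ℂ _ i) B = _
    rw [← singularCohomology.map_comp]
  rw [hgoal]
  apply singularCohomology_map_eq_zero_of_compact_homotopy
  intro K hK
  haveI : CompactSpace K := isCompact_iff_compactSpace.1 hK
  obtain ⟨U, hUrange, hUsm⟩ := hU
  haveI := hT
  haveI := hf
  haveI : Smooth T.hom := SmoothOfRelativeDimension.smooth 1 T.hom
  haveI : LocallyOfFiniteType T.hom := inferInstance
  -- an affine open `T₁ ∋ t₀` of the base and the smooth separated open piece `U₁ = U ∩ f⁻¹T₁`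
  obtain ⟨T₁', hT₁, ht₀T₁, -⟩ := (TopologicalSpace.Opens.isBasis_iff_nbhd.mp
    T.left.isBasis_affineOpens) (show t₀.pt ∈ (⊤ : T.left.Opens) from trivial)
  set T₁ : T.left.Opens := T₁' with hT₁def
  haveI : IsAffine (T₁ : Scheme) := hT₁
  set U₁ : W.left.Opens := U ⊓ f.left ⁻¹ᵁ T₁ with hU₁
  set M : SchemeOver ℂ := openSubschemeOver W U₁ with hM
  set iM : M ⟶ W := openSubschemeOverι W U₁ with hiM
  set fM : M ⟶ T := Over.homMk (U₁.ι ≫ f.left) (by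
    change (U₁.ι ≫ f.left) ≫ T.hom = U₁.ι ≫ W.hom
    rw [Category.assoc, Over.w f]) with hfM
  have hiMf : iM ≫ f = fM := Over.OverMorphism.ext rfl
  haveI : IsOpenImmersion iM.left := inferInstanceAs (IsOpenImmersion U₁.ι)
  -- `f` is smooth of relative dimension `n` on `U₁`, so `M` is smooth of relative dimension
  -- `n + 1` over `ℂ` and `fM` is a smooth morphism
  have hsm₁ : SmoothOfRelativeDimension n (U₁.ι ≫ f.left) := by
    haveI := hUsm
    have h : SmoothOfRelativeDimension (0 + n) (W.left.homOfLE (inf_le_left : U₁ ≤ U) ≫ U.ι ≫ f.left) :=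
      inferInstance
    rwa [Nat.zero_add, ← Category.assoc, Scheme.homOfLE_ι] at h
  haveI : SmoothOfRelativeDimension n fM.left := hsm₁
  haveI : Smooth fM.left := SmoothOfRelativeDimension.smooth n fM.left
  haveI : SmoothOfRelativeDimension (n + 1) M.hom := by
    rw [← Over.w fM]
    infer_instance
  haveI : LocallyOfFiniteType M.hom := by
    rw [← Over.w fM]
    infer_instance
  -- `M` is separated over `ℂ`: `U₁ ⟶ f⁻¹T₁ ⟶ T₁ ⟶ Spec ℂ`
  haveI : IsSeparated M.hom := by
    have hfac : M.hom = CategoryStruct.comp (W.left.homOfLE (inf_le_right : U₁ ≤ f.left ⁻¹ᵁ T₁))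
        (CategoryStruct.comp (f.left ∣_ T₁) (CategoryStruct.comp (Scheme.Opens.ι T₁) T.hom)) := by
      rw [← Category.assoc (f.left ∣_ T₁), morphismRestrict_ι, Category.assoc, Over.w f,
        ← Category.assoc, Scheme.homOfLE_ι]
      rfl
    haveI : IsAffineHom (CategoryStruct.comp (Scheme.Opens.ι T₁) T.hom) :=
      isAffineHom_of_isAffine _
    haveI h3 : IsSeparated (CategoryStruct.comp (Scheme.Opens.ι T₁) T.hom) := inferInstance
    haveI h2 : IsSeparated (f.left ∣_ T₁) := inferInstance
    haveI h1 : IsSeparated (W.left.homOfLE (inf_le_right : U₁ ≤ f.left ⁻¹ᵁ T₁)) := inferInstance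
    haveI h23 : IsSeparated (CategoryStruct.comp (f.left ∣_ T₁)
        (CategoryStruct.comp (Scheme.Opens.ι T₁) T.hom)) := inferInstance
    rw [hfac]
    exact MorphismProperty.IsStableUnderComposition.comp_mem (P := @IsSeparated) _ _ h1 h23
  -- second countability of `M(ℂ)`: `U₁` is quasi-compact (an open of the Noetherian `f⁻¹T₁`)
  haveI : SecondCountableTopology (ComplexPoints M) := by
    set W₁ : SchemeOver ℂ := openSubschemeOver W (f.left ⁻¹ᵁ T₁) with hW₁
    haveI : CompactSpace ↥(f.left ⁻¹ᵁ T₁) := QuasiCompact.compactSpace_of_compactSpace (f.left ∣_ T₁)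
    haveI : LocallyOfFiniteType W₁.hom := by
      change LocallyOfFiniteType ((f.left ⁻¹ᵁ T₁).ι ≫ W.hom)
      rw [← Over.w f]
      infer_instance
    haveI : CompactSpace W₁.left := inferInstanceAs (CompactSpace ↥(f.left ⁻¹ᵁ T₁))
    haveI : SecondCountableTopology (ComplexPoints W₁) :=
      ComplexPoints.secondCountableTopology_of_compactSpace_holds W₁
    have hw₁ : CategoryStruct.comp (W.left.homOfLE (inf_le_right : U₁ ≤ f.left ⁻¹ᵁ T₁)) W₁.hom =
        M.hom := by
      change CategoryStruct.comp (W.left.homOfLE _) (CategoryStruct.comp (f.left ⁻¹ᵁ T₁).ι W.hom) =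
        CategoryStruct.comp U₁.ι W.hom
      rw [← Category.assoc, Scheme.homOfLE_ι]
    let i₁ : M ⟶ W₁ := Over.homMk (W.left.homOfLE (inf_le_right : U₁ ≤ f.left ⁻¹ᵁ T₁)) hw₁
    haveI : IsOpenImmersion i₁.left :=
      inferInstanceAs (IsOpenImmersion (W.left.homOfLE (inf_le_right : U₁ ≤ f.left ⁻¹ᵁ T₁)))
    exact (AlgPoints.isOpenEmbedding_map_holds (L := ℂ) i₁).isEmbedding.secondCountableTopology
  -- the points of `K`, pushed into `W(ℂ)`, lie in `U₁(ℂ)` over `t₀` and off `𝒵(ℂ)`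
  have hι₀f : ∀ κ : K, AlgPoints.map f (ι₀ κ.1) = t₀ := fun κ => by
    change AlgPoints.map f (AlgPoints.map (j ≫ fiberι f t₀) κ.1.1) = t₀
    rw [AlgPoints.map_comp_apply, AlgPoints.map_map_fiberι]
  have hι₀U₁ : ∀ κ : K, (ι₀ κ.1).pt ∈ U₁ := fun κ => by
    refine ⟨hUrange ⟨κ.1.1.pt, rfl⟩, ?_⟩
    change f.left.base (ι₀ κ.1).pt ∈ T₁
    rw [← AlgPoints.pt_map, hι₀f]
    exact ht₀T₁
  have hι₀𝒵 : ∀ κ : K, (ι₀ κ.1).pt ∉ 𝒵 := fun κ => κ.1.2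
  -- lift them to `M(ℂ)` along the open embedding `iM(ℂ)`
  have hiMe : Topology.IsOpenEmbedding (AlgPoints.map (L := ℂ) iM) :=
    AlgPoints.isOpenEmbedding_map_holds iM
  set eM := hiMe.isEmbedding.toHomeomorph with heM
  have hrange : ∀ κ : K, ι₀ κ.1 ∈ Set.range (AlgPoints.map (L := ℂ) iM) := fun κ => by
    rw [AlgPoints.range_map_of_isOpenImmersion_holds iM]
    change (ι₀ κ.1).pt ∈ U₁.ι.opensRange
    rw [Scheme.Opens.opensRange_ι]
    exact hι₀U₁ κ
  have hlift : ∀ κ : K, AlgPoints.map iM (eM.symm ⟨ι₀ κ.1, hrange κ⟩) = ι₀ κ.1 := fun κ => by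
    obtain ⟨Q, hQ⟩ := hrange κ
    have h : eM.symm ⟨ι₀ κ.1, hrange κ⟩ = Q := by
      rw [Homeomorph.symm_apply_eq]
      ext : 1
      exact hQ.symm
    rw [h, hQ]
  set e : C(K, ComplexPoints M) := ⟨fun κ => eM.symm ⟨ι₀ κ.1, hrange κ⟩,
    eM.symm.continuous.comp ((ι₀.continuous.comp continuous_subtype_val).subtype_mk _)⟩ with hedef
  have he : ∀ κ, AlgPoints.map fM (e κ) = t₀ := fun κ => by
    rw [← hiMf, AlgPoints.map_comp_apply]
    change AlgPoints.map f (AlgPoints.map iM (eM.symm ⟨ι₀ κ.1, hrange κ⟩)) = t₀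
    rw [hlift, hι₀f]
  set C : Set (ComplexPoints M) := {P | (AlgPoints.map iM P).pt ∈ 𝒵} with hCdef
  have hC : IsClosed C :=
    h𝒵.preimage ((continuous_pt_complexPoints W).comp (AlgPoints.continuous_map iM))
  have heC : ∀ κ, e κ ∉ C := fun κ => by
    change (AlgPoints.map iM (eM.symm ⟨ι₀ κ.1, hrange κ⟩)).pt ∉ 𝒵
    rw [hlift]
    exact hι₀𝒵 κ
  -- move them to a nearby fibre `W_{t₁}`, `t₁ ≠ t₀`, off `𝒵(ℂ)`
  obtain ⟨t₁, ht₁, Γ, hΓ0, hΓ1, hΓC⟩ := exists_motion_off_fibre (d := n + 1) fM t₀ hC e he heC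
  -- the fibre over `t₁` off its slice of `𝒵`, where `B` dies
  set i' : C(complexPointsCompl (fiberOver f t₁) ((fiberι f t₁).left.base ⁻¹' 𝒵), ComplexPoints W) :=
    (AlgPoints.mapContinuous (L := ℂ) (fiberι f t₁)).comp ⟨Subtype.val, continuous_subtype_val⟩
    with hi'
  have hi'B : singularCohomology.map ℂ ℂ i' i B = 0 := by
    have h := hdies t₁ ht₁
    change (singularCohomology.map ℂ ℂ _ i ≫ singularCohomology.map ℂ ℂ _ i) B = 0 at h
    rwa [← singularCohomology.map_comp] at h
  -- lift the moved points into `W_{t₁}(ℂ)` along the closed embedding `ι_{t₁}(ℂ)`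
  haveI := isClosedImmersion_fiberι_left f t₁
  have hι₁e : Topology.IsEmbedding (AlgPoints.map (L := ℂ) (fiberι f t₁)) :=
    AlgPoints.isEmbedding_map_of_isClosedImmersion (fiberι f t₁)
  set e₁ := hι₁e.toHomeomorph with he₁
  have hrange₁ : ∀ κ : K, AlgPoints.map iM (Γ (1, κ)) ∈
      Set.range (AlgPoints.map (L := ℂ) (fiberι f t₁)) := fun κ => by
    rw [AlgPoints.range_map_fiberι, Set.mem_preimage, Set.mem_singleton_iff,
      ← AlgPoints.map_comp_apply, hiMf]
    exact hΓ1 κ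
  have hlift₁ : ∀ κ : K, AlgPoints.map (fiberι f t₁) (e₁.symm ⟨_, hrange₁ κ⟩) =
      AlgPoints.map iM (Γ (1, κ)) := fun κ => by
    obtain ⟨Q, hQ⟩ := hrange₁ κ
    have h : e₁.symm ⟨_, hrange₁ κ⟩ = Q := by
      rw [Homeomorph.symm_apply_eq]
      ext : 1
      exact hQ.symm
    rw [h, hQ]
  have hnotin : ∀ κ : K, (e₁.symm ⟨_, hrange₁ κ⟩).pt ∉ (fiberι f t₁).left.base ⁻¹' 𝒵 :=
      fun κ => by
    change (fiberι f t₁).left.base (e₁.symm ⟨_, hrange₁ κ⟩).pt ∉ 𝒵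
    rw [← AlgPoints.pt_map, hlift₁]
    exact hΓC κ
  have hcontP : Continuous fun κ : K =>
      (⟨AlgPoints.map iM (Γ (1, κ)), hrange₁ κ⟩ : Set.range (AlgPoints.map (L := ℂ) (fiberι f t₁))) :=
    ((AlgPoints.continuous_map iM).comp
      (Γ.continuous.comp (continuous_const.prodMk continuous_id))).subtype_mk _
  have hcontψ : Continuous fun κ : K =>
      (⟨e₁.symm ⟨_, hrange₁ κ⟩, hnotin κ⟩ :
        complexPointsCompl (fiberOver f t₁) ((fiberι f t₁).left.base ⁻¹' 𝒵)) :=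
    (e₁.symm.continuous.comp hcontP).subtype_mk _
  let ψK : C(K, complexPointsCompl (fiberOver f t₁) ((fiberι f t₁).left.base ⁻¹' 𝒵)) :=
    ⟨fun κ => ⟨e₁.symm ⟨_, hrange₁ κ⟩, hnotin κ⟩, hcontψ⟩
  refine ⟨complexPointsCompl (fiberOver f t₁) ((fiberι f t₁).left.base ⁻¹' 𝒵), inferInstance, i',
    ψK, hi'B, ⟨?_⟩⟩
  -- the motion is the homotopy, run backwards
  refine
    { toFun := fun x => AlgPoints.map iM (Γ (1 - (x.1 : ℝ), x.2))
      continuous_toFun := (AlgPoints.continuous_map iM).comp (Γ.continuous.comp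
        ((continuous_const.sub (continuous_induced_dom.comp continuous_fst)).prodMk continuous_snd))
      map_zero_left := fun κ => ?_
      map_one_left := fun κ => ?_ }
  · change AlgPoints.map iM (Γ (1 - 0, κ)) = AlgPoints.map (fiberι f t₁) (e₁.symm ⟨_, hrange₁ κ⟩)
    rw [sub_zero, hlift₁]
  · change AlgPoints.map iM (Γ (1 - 1, κ)) = ι₀ κ.1
    rw [sub_self, hΓ0]
    exact hlift κ

end Limit

end Summit.HodgeConjecture.HodgeConjecture.Theorems

end
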